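import Literature.NumberTheory.LFunctions.Zhang2022.DetectorShiftDoubledParseval
import Literature.NumberTheory.LFunctions.Zhang2022.DetectorDoublingIdentity
import Literature.NumberTheory.LFunctions.Zhang2022.MainTermFormPSD

/-!
# Zhang (2022), programme F-S3 (cell landau-siegel §E, E-010(ii) / KNIFE-EDGES §4, identity Id-6): the PRINTED
# main-term form `𝔅` is the bulk form `T_{(1,2,3)}` of ONE `C¹` function on the circle `ℝ/2ℤ` — Parseval-diagonal,
# window / overlap INCLUDED (`g(1) ≠ 0` and kinks allowed)

Y. Zhang, *Discrete mean estimates and the Landau–Siegel zero*, arXiv:2211.02515v1 [Zhang2022LandauSiegel] — an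
unrefereed manuscript under adjudication. **WHAT THIS IS NOT: not a claim about Theorems 1–2 of arXiv:2211.02515, about
Landau–Siegel zeros, or about Parity; nothing here asserts any claim of the manuscript. The programme SEARCHES and TYPES;
no claim about Landau–Siegel zeros, Theorems 1–2 of arXiv:2211.02515 or a repaired Margin232 until a kernel theorem says so.**
Seat ls-Bmulti-typer-2 g4 (pen; ls-lead g2 ruling 2026-08-27T03:03:50Z «GO Id-6»); identity found and certified two-lineage
by ls-num-2 g4 (TWOSIDED-DOUBLING-B.md c18e1c52722db013, kit j266016, 2026-08-27T02:37:15Z (2)) and ls-num-1 g3 (kit j266169);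
referee ls-theory g2 2026-08-27T02:50:28Z (b)/(c).

## What is here (all theorems and explicit definitions; 0 facts)

Write `a₀ = g(0)`, `a₁ = g(1)`, `w = ∫₀¹ g`, `S_g = Det.tailPrim g = ∫_y^1 g` (so `S_g(0) = w`, `S_g(1) = 0`, `S_g′ = −g`), and
`T_b^{[a,c]}` for the bulk form `Det.bulkFormOn b a c` (`DetectorShiftClosedForm`, [K1]).

* Part 1 — `Det.bulkFormOn_extremal_eq_jetBracket_on`: the [K2] integration-by-parts identity
  `T_b^{[a,c]}(F) = Re J(c) − Re J(a)` for an exponential extremal `F = Det.extremal b γ` on ANY interval (the tree's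
  `Det.bulkFormOn_extremal_eq_jetBracket` is the case `[0,1]`; same proof, via the public `Det.hasDerivAt_jetBracket` and
  `Det.bulkDensity_eq_re_jetBracketD`).
* Part 2 — `Det.stdBridgeCoeff a₀ a₁ w : Fin 4 → ℂ`, the EXPLICIT solution of the two-point interpolation problem in the
  Euler–Lagrange span `{1, e^{−iπt}, e^{−2iπt}, e^{−3iπt}}` of the printed triple `b = (1,2,3)`:
  `γ₀ = w/2 + i(a₀+a₁)/(4π)`, `γ₁ = 3w/4 + i(a₀−a₁)/(4π)`, `γ₂ = −i(a₀+a₁)/(4π)`, `γ₃ = −w/4 − i(a₀−a₁)/(4π)`; the BRIDGE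
  `F_{a₀,a₁,w} := Det.extremal ![1,2,3] (stdBridgeCoeff a₀ a₁ w)` (written out in every statement; no separate def)
  has `(F, F′)(0) = (w, −a₀)` and `(F, F′)(−1) = (0, −a₁)`
  (`stdBridge_zero`, `stdBridgeD_zero`, `stdBridge_neg_one`, `stdBridgeD_neg_one`) and explicit `F″`, `F‴` at `0`, `−1`.
* Part 3 — **`Det.bulkFormOn_stdBridge`: `T_{(1,2,3)}^{[−1,0]}(F) = −3π²·Re(w̄(a₀+a₁)) + 2π·Im(a₀ā₁)`** — the residual
  JET IDENTITY of Id-6 (ls-num-2 g4: «exact over ℚ(i) on a polarisation basis 9/9»): the boundary part of the printed `𝔅`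
  IS the bulk energy of the bridge.
* Part 4 — `pi_div_eight_mul_mainTermForm_eq`: `(π/8)·𝔅(g) = Re Q_{(6,11,6)}(g,g) − 3π²Re(w̄(a₀+a₁)) + 2πIm(a₀ā₁)` for
  EVERY pair `(g, g′)` (pure bookkeeping against `mainTermForm_eq` and `Det.re_shiftCore_self`), and
  `Det.bulkFormOn_std_tailPrim`: `T_{(1,2,3)}^{[0,1]}(S_g) = Re Q_{(6,11,6)}(g,g)` (the tree's [K1] dictionary
  `Det.bulkFormOn_tailPrim_eq_re_shiftCore` at the printed triple).
* Part 5 — the DOUBLED function `mainTermDoubled g := Det.glue F S_g` on `[−1, 1]` (bridge on `[−1,0]`, tail primitive on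
  `[0,1]`; `C¹` at the node `0` and `2`-periodic `C¹` at `±1` BY CONSTRUCTION) with its derivative data
  `mainTermDoubledD g`, `mainTermDoubledDD g g′`, and the two theorems of record, for every KINKED profile
  `Repair.KinkedProfile g g′` (continuous, right-differentiable on `(0,1)`, `g′ ∈ L²`: every `C¹` profile —
  `IsC1OnUnitInterval.kinkedProfile`, `mainTermForm_hasSum_circle_of_isC1` — and the glued profiles of §18, kink included;
  NO vanishing condition at `1`):
  **`pi_div_eight_mul_mainTermForm_eq_bulkFormOn`: `(π/8)·mainTermForm g g′ = T_{(1,2,3)}^{[−1,1]}(mainTermDoubled g)`**, and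
  **`mainTermForm_hasSum_circle`:
  `HasSum (m : ℤ ↦ 4π³·m(m+1)(m+2)(m+3)·|∫_{−1}^{1} (mainTermDoubled g) e^{−iπm·}|²) (mainTermForm g g′)`** — by the tree's
  [K3′] `Det.hasSum_bulkFormOn_circle` (base point `−1`, node set `{0}`). Corollaries: `mainTermForm_nonneg` re-derived by
  Parseval (`mainTermForm_nonneg_of_hasSum_circle`) and the coefficient form of the kernel
  `mainTermForm_eq_zero_iff_dpiece` (`𝔅(g) = 0` iff the doubled function has no Fourier mass off `m ∈ {0,−1,−2,−3}`, i.e. is a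
  cubic lattice trigonometric polynomial on the circle — the coefficient shadow of the tree's `mainTermForm_eq_zero_iff_afeSpan`,
  `g ∈ span{e^{−iπy}, e^{−2iπy}, e^{−3iπy}}`, equivalently `S̃_g ∈ span{1, e^{−iπy}, e^{−2iπy}, e^{−3iπy}}`).

## Why (the structural reading, ls-theory g2 02:50:28Z (b))

At the printed design the main-term functional of §18 (`C232S = 𝔅(𝔤_θ)`, `Repair.C232S_eq_frakc`) sits on the 4-integer
CORNER `(1,2,3)` of the admissible box: its Parseval symbol `m(m+1)(m+2)(m+3)` vanishes at four consecutive lattice points,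
the maximal-kernel point. The one-sided case `g(1) = 0` is [K1]+[K2] (D1) at `b = (1,2,3)` with a CLAMPED bridge; the content
of this file is the two-point (unclamped) bridge, i.e. the window/overlap case.

Elementary calculus throughout (explicit trigonometric polynomials, integration by parts, the tree's Parseval on a period
cell). References: Y. Zhang, arXiv:2211.02515v1 (2022), §7 Prop. 7.1 p.44; §8 (8.11)–(8.23); §18.
[cite: Zhang2022LandauSiegel, §7 Prop 7.1 p.44; §8 (8.11)–(8.23)]
-/

noncomputable section

open Complex Real Set intervalIntegral Filter Topology
open _root_.MeasureTheory
open scoped ComplexConjugate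

namespace Literature.NumberTheory.LFunctions.Zhang2022

namespace Det

/-! ### Part 1 — [K2] integration by parts on a general interval -/

section ByParts

variable (b : Fin 3 → ℝ) (γ : Fin 4 → ℂ)

/-- Continuity of the real part of the derivative of the jet bracket. [cite: Zhang2022LandauSiegel, §7 Prop 7.1 p.44] -/
theorem continuous_re_jetBracketD : Continuous (fun t => (jetBracketD b γ t).re) := by
  have hm : ∀ (m : Fin 3) (k : ℕ) (c : ℂ), Continuous (fun s : ℝ => c * (-(I * π * (b m : ℂ))) ^ k *
      cexp (-(I * π * (b m : ℂ) * s))) := by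
    intro m k c
    exact continuous_const.mul (Complex.continuous_exp.comp
      ((continuous_const.mul Complex.continuous_ofReal).neg))
  have hF : Continuous (extremal b γ) :=
    continuous_iff_continuousAt.2 fun t => (hasDerivAt_extremal b γ t).continuousAt
  have hF1 : Continuous (extremalD b γ) :=
    continuous_iff_continuousAt.2 fun t => (hasDerivAt_extremalD b γ t).continuousAt
  have hF2 : Continuous (extremalDD b γ) :=
    continuous_iff_continuousAt.2 fun t => (hasDerivAt_extremalDD b γ t).continuousAt
  have hF3 : Continuous (extremalDDD b γ) :=
    continuous_iff_continuousAt.2 fun t => (hasDerivAt_extremalDDD b γ t).continuousAt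
  have hF4 : Continuous (extremalDDDD b γ) := by
    unfold extremalDDDD; exact continuous_finsetSum _ (fun m _ => hm m 4 (γ m.succ))
  have hJ : Continuous (jetBracketD b γ) := by
    unfold jetBracketD
    fun_prop
  exact Complex.continuous_re.comp hJ

/-- **[K2] integration by parts on `[a, c]`**: the bulk energy of an exponential extremal `F = extremal b γ` on any
interval is the boundary jet bracket, `T_b^{[a,c]}(F) = Re J(c) − Re J(a)` (the tree's
`bulkFormOn_extremal_eq_jetBracket` is `[a,c] = [0,1]`). [cite: Zhang2022LandauSiegel, §7 Prop 7.1 p.44; §2 (2.32)–(2.33)] -/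
theorem bulkFormOn_extremal_eq_jetBracket_on (a c : ℝ) :
    bulkFormOn b a c (extremal b γ) (extremalD b γ) (extremalDD b γ)
      = (jetBracket b γ c).re - (jetBracket b γ a).re := by
  unfold bulkFormOn
  have hderiv : ∀ t ∈ Set.uIcc a c, HasDerivAt (fun s => (jetBracket b γ s).re) ((jetBracketD b γ t).re) t := by
    intro t _
    exact Complex.reCLM.hasFDerivAt.comp_hasDerivAt t (hasDerivAt_jetBracket b γ t)
  rw [← intervalIntegral.integral_eq_sub_of_hasDerivAt hderiv ((continuous_re_jetBracketD b γ).intervalIntegrable a c)]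
  refine intervalIntegral.integral_congr (fun t _ => ?_)
  exact bulkDensity_eq_re_jetBracketD b γ t

end ByParts

/-! ### Part 2 — the standard bridge: the explicit two-point solve at the printed triple `(1,2,3)` -/

section Bridge

/-- **The bridge coefficients at `b = (1,2,3)`**: the unique `F = γ₀ + γ₁e^{−iπt} + γ₂e^{−2iπt} + γ₃e^{−3iπt}` with
two-point jet data `(F,F′)(0) = (w, −a₀)`, `(F,F′)(−1) = (0, −a₁)` (equivalently at `2` and `1`, by `2`-periodicity):
`γ₀ = w/2 + i(a₀+a₁)/(4π)`, `γ₁ = 3w/4 + i(a₀−a₁)/(4π)`, `γ₂ = −i(a₀+a₁)/(4π)`, `γ₃ = −w/4 − i(a₀−a₁)/(4π)`.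
[cite: Zhang2022LandauSiegel, §7 Prop 7.1 p.44] -/
def stdBridgeCoeff (a₀ a₁ w : ℂ) : Fin 4 → ℂ :=
  ![w / 2 + I * (a₀ + a₁) / (4 * π), 3 * w / 4 + I * (a₀ - a₁) / (4 * π),
    -(I * (a₀ + a₁) / (4 * π)), -(w / 4) - I * (a₀ - a₁) / (4 * π)]

variable (a₀ a₁ w : ℂ)

/-- Entry `0`. [cite: Zhang2022LandauSiegel, §7 Prop 7.1 p.44] -/
@[simp] theorem stdBridgeCoeff_zero : stdBridgeCoeff a₀ a₁ w 0 = w / 2 + I * (a₀ + a₁) / (4 * π) := rfl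

/-- Entry `succ 0`. [cite: Zhang2022LandauSiegel, §7 Prop 7.1 p.44] -/
@[simp] theorem stdBridgeCoeff_succ_zero :
    stdBridgeCoeff a₀ a₁ w (Fin.succ 0) = 3 * w / 4 + I * (a₀ - a₁) / (4 * π) := rfl

/-- Entry `succ 1`. [cite: Zhang2022LandauSiegel, §7 Prop 7.1 p.44] -/
@[simp] theorem stdBridgeCoeff_succ_one :
    stdBridgeCoeff a₀ a₁ w (Fin.succ 1) = -(I * (a₀ + a₁) / (4 * π)) := rfl

/-- Entry `succ 2`. [cite: Zhang2022LandauSiegel, §7 Prop 7.1 p.44] -/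
@[simp] theorem stdBridgeCoeff_succ_two :
    stdBridgeCoeff a₀ a₁ w (Fin.succ 2) = -(w / 4) - I * (a₀ - a₁) / (4 * π) := rfl

/-- The three modes at `t = 0`. [folklore] -/
private theorem modes_zero :
    cexp (-(I * π * (((![1, 2, 3] : Fin 3 → ℝ) 0 : ℝ) : ℂ) * ((0:ℝ) : ℂ))) = 1 ∧
    cexp (-(I * π * (((![1, 2, 3] : Fin 3 → ℝ) 1 : ℝ) : ℂ) * ((0:ℝ) : ℂ))) = 1 ∧
    cexp (-(I * π * (((![1, 2, 3] : Fin 3 → ℝ) 2 : ℝ) : ℂ) * ((0:ℝ) : ℂ))) = 1 := by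
  simp

/-- The three modes at `t = −1`: `e^{iπ} = −1`, `e^{2iπ} = 1`, `e^{3iπ} = −1`. [folklore] -/
private theorem modes_neg_one :
    cexp (-(I * π * (((![1, 2, 3] : Fin 3 → ℝ) 0 : ℝ) : ℂ) * ((-1:ℝ) : ℂ))) = -1 ∧
    cexp (-(I * π * (((![1, 2, 3] : Fin 3 → ℝ) 1 : ℝ) : ℂ) * ((-1:ℝ) : ℂ))) = 1 ∧
    cexp (-(I * π * (((![1, 2, 3] : Fin 3 → ℝ) 2 : ℝ) : ℂ) * ((-1:ℝ) : ℂ))) = -1 := by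
  have h0 : (((![1, 2, 3] : Fin 3 → ℝ) 0 : ℝ) : ℂ) = 1 := by simp
  have h1 : (((![1, 2, 3] : Fin 3 → ℝ) 1 : ℝ) : ℂ) = 2 := by simp
  have h2 : (((![1, 2, 3] : Fin 3 → ℝ) 2 : ℝ) : ℂ) = 3 := by simp
  rw [h0, h1, h2]
  have e1 : -(I * π * (1:ℂ) * ((-1:ℝ) : ℂ)) = π * I := by push_cast; ring
  have e2 : -(I * π * (2:ℂ) * ((-1:ℝ) : ℂ)) = 2 * π * I := by push_cast; ring
  have e3 : -(I * π * (3:ℂ) * ((-1:ℝ) : ℂ)) = π * I + 2 * π * I := by push_cast; ring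
  refine ⟨?_, ?_, ?_⟩
  · rw [e1, Complex.exp_pi_mul_I]
  · rw [e2, Complex.exp_two_pi_mul_I]
  · rw [e3, Complex.exp_add, Complex.exp_pi_mul_I, Complex.exp_two_pi_mul_I, mul_one]

/-- The shift entries as complex numbers. [folklore] -/
private theorem std_entries :
    (((![1, 2, 3] : Fin 3 → ℝ) 0 : ℝ) : ℂ) = 1 ∧ (((![1, 2, 3] : Fin 3 → ℝ) 1 : ℝ) : ℂ) = 2 ∧
    (((![1, 2, 3] : Fin 3 → ℝ) 2 : ℝ) : ℂ) = 3 := by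
  refine ⟨by simp, by simp, by simp⟩

/-- `F(0) = w`. [cite: Zhang2022LandauSiegel, §7 Prop 7.1 p.44] -/
theorem stdBridge_zero : extremal ![1, 2, 3] (stdBridgeCoeff a₀ a₁ w) 0 = w := by
  have hπ : (π : ℂ) ≠ 0 := by exact_mod_cast Real.pi_ne_zero
  unfold extremal
  simp only [Fin.sum_univ_three, stdBridgeCoeff_zero, stdBridgeCoeff_succ_zero, stdBridgeCoeff_succ_one,
    stdBridgeCoeff_succ_two, modes_zero.1, modes_zero.2.1, modes_zero.2.2, mul_one]
  field_simp
  ring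

/-- `F′(0) = −a₀`. [cite: Zhang2022LandauSiegel, §7 Prop 7.1 p.44] -/
theorem stdBridgeD_zero : extremalD ![1, 2, 3] (stdBridgeCoeff a₀ a₁ w) 0 = -a₀ := by
  have hπ : (π : ℂ) ≠ 0 := by exact_mod_cast Real.pi_ne_zero
  unfold extremalD
  simp only [Fin.sum_univ_three, stdBridgeCoeff_succ_zero, stdBridgeCoeff_succ_one,
    stdBridgeCoeff_succ_two, modes_zero.1, modes_zero.2.1, modes_zero.2.2]
  simp only [std_entries.1, std_entries.2.1, std_entries.2.2, mul_one]
  field_simp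
  ring_nf
  simp only [Complex.I_sq]
  ring

/-- `F(−1) = 0`. [cite: Zhang2022LandauSiegel, §7 Prop 7.1 p.44] -/
theorem stdBridge_neg_one : extremal ![1, 2, 3] (stdBridgeCoeff a₀ a₁ w) (-1) = 0 := by
  have hπ : (π : ℂ) ≠ 0 := by exact_mod_cast Real.pi_ne_zero
  unfold extremal
  simp only [Fin.sum_univ_three, stdBridgeCoeff_zero, stdBridgeCoeff_succ_zero, stdBridgeCoeff_succ_one,
    stdBridgeCoeff_succ_two, modes_neg_one.1, modes_neg_one.2.1, modes_neg_one.2.2, mul_one, mul_neg_one]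
  field_simp
  ring

/-- `F′(−1) = −a₁`. [cite: Zhang2022LandauSiegel, §7 Prop 7.1 p.44] -/
theorem stdBridgeD_neg_one : extremalD ![1, 2, 3] (stdBridgeCoeff a₀ a₁ w) (-1) = -a₁ := by
  have hπ : (π : ℂ) ≠ 0 := by exact_mod_cast Real.pi_ne_zero
  unfold extremalD
  simp only [Fin.sum_univ_three, stdBridgeCoeff_succ_zero, stdBridgeCoeff_succ_one,
    stdBridgeCoeff_succ_two, modes_neg_one.1, modes_neg_one.2.1, modes_neg_one.2.2]
  simp only [std_entries.1, std_entries.2.1, std_entries.2.2, mul_one, mul_neg_one]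
  field_simp
  ring_nf
  simp only [Complex.I_sq]
  ring

/-- `F″(0) = (3π²/2)·w + iπ(3a₀ − a₁)`. [cite: Zhang2022LandauSiegel, §7 Prop 7.1 p.44] -/
theorem stdBridgeDD_zero : extremalDD ![1, 2, 3] (stdBridgeCoeff a₀ a₁ w) 0
    = 3 * (π : ℂ) ^ 2 / 2 * w + I * π * (3 * a₀ - a₁) := by
  have hπ : (π : ℂ) ≠ 0 := by exact_mod_cast Real.pi_ne_zero
  unfold extremalDD
  simp only [Fin.sum_univ_three, stdBridgeCoeff_succ_zero, stdBridgeCoeff_succ_one,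
    stdBridgeCoeff_succ_two, modes_zero.1, modes_zero.2.1, modes_zero.2.2]
  simp only [std_entries.1, std_entries.2.1, std_entries.2.2, mul_one]
  field_simp
  ring_nf
  simp only [Complex.I_sq, Complex.I_pow_three]
  ring

/-- `F″(−1) = −(3π²/2)·w − iπ(a₀ − 3a₁)`. [cite: Zhang2022LandauSiegel, §7 Prop 7.1 p.44] -/
theorem stdBridgeDD_neg_one : extremalDD ![1, 2, 3] (stdBridgeCoeff a₀ a₁ w) (-1)
    = -(3 * (π : ℂ) ^ 2 / 2 * w) - I * π * (a₀ - 3 * a₁) := by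
  have hπ : (π : ℂ) ≠ 0 := by exact_mod_cast Real.pi_ne_zero
  unfold extremalDD
  simp only [Fin.sum_univ_three, stdBridgeCoeff_succ_zero, stdBridgeCoeff_succ_one,
    stdBridgeCoeff_succ_two, modes_neg_one.1, modes_neg_one.2.1, modes_neg_one.2.2]
  simp only [std_entries.1, std_entries.2.1, std_entries.2.2, mul_one, mul_neg_one]
  field_simp
  ring_nf
  simp only [Complex.I_sq, Complex.I_pow_three]
  ring

/-- `F‴(0) = −6iπ³·w + π²(17a₀ − 9a₁)/2`. [cite: Zhang2022LandauSiegel, §7 Prop 7.1 p.44] -/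
theorem stdBridgeDDD_zero : extremalDDD ![1, 2, 3] (stdBridgeCoeff a₀ a₁ w) 0
    = -(6 * I * (π : ℂ) ^ 3 * w) + (π : ℂ) ^ 2 * (17 * a₀ - 9 * a₁) / 2 := by
  have hπ : (π : ℂ) ≠ 0 := by exact_mod_cast Real.pi_ne_zero
  unfold extremalDDD
  simp only [Fin.sum_univ_three, stdBridgeCoeff_succ_zero, stdBridgeCoeff_succ_one,
    stdBridgeCoeff_succ_two, modes_zero.1, modes_zero.2.1, modes_zero.2.2]
  simp only [std_entries.1, std_entries.2.1, std_entries.2.2, mul_one]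
  field_simp
  ring_nf
  simp only [Complex.I_pow_three, Complex.I_pow_four]
  ring

/-- `F‴(−1) = 6iπ³·w − π²(9a₀ − 17a₁)/2`. [cite: Zhang2022LandauSiegel, §7 Prop 7.1 p.44] -/
theorem stdBridgeDDD_neg_one : extremalDDD ![1, 2, 3] (stdBridgeCoeff a₀ a₁ w) (-1)
    = 6 * I * (π : ℂ) ^ 3 * w - (π : ℂ) ^ 2 * (9 * a₀ - 17 * a₁) / 2 := by
  have hπ : (π : ℂ) ≠ 0 := by exact_mod_cast Real.pi_ne_zero
  unfold extremalDDD
  simp only [Fin.sum_univ_three, stdBridgeCoeff_succ_zero, stdBridgeCoeff_succ_one,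
    stdBridgeCoeff_succ_two, modes_neg_one.1, modes_neg_one.2.1, modes_neg_one.2.2]
  simp only [std_entries.1, std_entries.2.1, std_entries.2.2, mul_one, mul_neg_one]
  field_simp
  ring_nf
  simp only [Complex.I_pow_three, Complex.I_pow_four]
  ring

end Bridge

/-! ### Part 3 — the bulk energy of the bridge is the boundary part of the printed form (the jet identity of Id-6) -/

section BridgeEnergy

variable (a₀ a₁ w : ℂ)

/-- The symmetric functions of the printed triple inside the jet bracket: `e₁ = 6`, `e₂ = 11`, `e₃ = 6`. [folklore] -/
private theorem std_sym :
    ((![1, 2, 3] : Fin 3 → ℝ) 0 + (![1, 2, 3] : Fin 3 → ℝ) 1 + (![1, 2, 3] : Fin 3 → ℝ) 2 : ℝ) = 6 ∧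
    ((![1, 2, 3] : Fin 3 → ℝ) 0 * (![1, 2, 3] : Fin 3 → ℝ) 1 + (![1, 2, 3] : Fin 3 → ℝ) 1 * (![1, 2, 3] : Fin 3 → ℝ) 2
      + (![1, 2, 3] : Fin 3 → ℝ) 2 * (![1, 2, 3] : Fin 3 → ℝ) 0 : ℝ) = 11 ∧
    ((![1, 2, 3] : Fin 3 → ℝ) 0 * (![1, 2, 3] : Fin 3 → ℝ) 1 * (![1, 2, 3] : Fin 3 → ℝ) 2 : ℝ) = 6 := by
  simp only [Matrix.cons_val_zero, Matrix.cons_val_one, Matrix.head_cons, Matrix.cons_val_two, Matrix.tail_cons]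
  norm_num

/-- Pointwise algebra of the jet identity: the two bracket values against the target. [folklore] -/
private theorem bridge_bracket_aux (a₀ a₁ w : ℂ) :
    (conj (-a₀) * (3 * (π : ℂ) ^ 2 / 2 * w + I * π * (3 * a₀ - a₁) + I * π * ((6 : ℝ) : ℂ) / 2 * -a₀)
        + conj w * (-(-(6 * I * (π : ℂ) ^ 3 * w) + (π : ℂ) ^ 2 * (17 * a₀ - 9 * a₁) / 2)
          - I * π * ((6 : ℝ) : ℂ) * (3 * (π : ℂ) ^ 2 / 2 * w + I * π * (3 * a₀ - a₁))
          + (π : ℂ) ^ 2 * ((11 : ℝ) : ℂ) * -a₀ + I * (π : ℂ) ^ 3 * ((6 : ℝ) : ℂ) / 2 * w)).re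
      - (conj (-a₁) * (-(3 * (π : ℂ) ^ 2 / 2 * w) - I * π * (a₀ - 3 * a₁) + I * π * ((6 : ℝ) : ℂ) / 2 * -a₁)
        + conj (0 : ℂ) * (-(6 * I * (π : ℂ) ^ 3 * w - (π : ℂ) ^ 2 * (9 * a₀ - 17 * a₁) / 2)
          - I * π * ((6 : ℝ) : ℂ) * (-(3 * (π : ℂ) ^ 2 / 2 * w) - I * π * (a₀ - 3 * a₁))
          + (π : ℂ) ^ 2 * ((11 : ℝ) : ℂ) * -a₁ + I * (π : ℂ) ^ 3 * ((6 : ℝ) : ℂ) / 2 * 0)).re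
      = -(3 * π ^ 2) * (conj w * (a₀ + a₁)).re + 2 * π * (a₀ * conj a₁).im := by
  simp only [map_neg, map_zero, zero_mul, mul_zero, add_zero, Complex.add_re, Complex.sub_re, Complex.neg_re,
    Complex.mul_re, Complex.mul_im, Complex.add_im, Complex.sub_im, Complex.neg_im, Complex.conj_re,
    Complex.conj_im, Complex.I_re, Complex.I_im, Complex.ofReal_re, Complex.ofReal_im, Complex.div_ofNat_re,
    Complex.div_ofNat_im, Complex.re_ofNat, Complex.im_ofNat]
  simp only [← Complex.ofReal_pow, Complex.ofReal_re, Complex.ofReal_im]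
  ring

/-- **The jet identity of Id-6**: the bulk energy of the standard bridge on `[−1, 0]` is the boundary (jet) part of
the printed main-term form, `T_{(1,2,3)}^{[−1,0]}(F_{a₀,a₁,w}) = −3π²·Re(w̄(a₀+a₁)) + 2π·Im(a₀ā₁)` (certified
exact over `ℚ(i)` two-lineage: ls-num-2 g4 kit j266016, ls-num-1 g3 kit j266169).
[cite: Zhang2022LandauSiegel, §7 Prop 7.1 p.44; §8 (8.11)–(8.23)] -/
theorem bulkFormOn_stdBridge :
    bulkFormOn ![1, 2, 3] (-1) 0 (extremal ![1, 2, 3] (stdBridgeCoeff a₀ a₁ w))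
        (extremalD ![1, 2, 3] (stdBridgeCoeff a₀ a₁ w)) (extremalDD ![1, 2, 3] (stdBridgeCoeff a₀ a₁ w))
      = -(3 * π ^ 2) * (conj w * (a₀ + a₁)).re + 2 * π * (a₀ * conj a₁).im := by
  rw [bulkFormOn_extremal_eq_jetBracket_on]
  unfold jetBracket
  rw [stdBridge_zero, stdBridgeD_zero, stdBridgeDD_zero, stdBridgeDDD_zero, stdBridge_neg_one,
    stdBridgeD_neg_one, stdBridgeDD_neg_one, stdBridgeDDD_neg_one, std_sym.1, std_sym.2.1, std_sym.2.2]
  exact bridge_bracket_aux a₀ a₁ w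

end BridgeEnergy

/-! ### Part 4 — the printed form against the core form `Q_{(6,11,6)}`, and the tail-primitive piece -/

section Printed

/-- `conj` commutes with the interval integral. [folklore] -/
private theorem conj_intervalIntegral' (f : ℝ → ℂ) (a c : ℝ) :
    conj (∫ x in a..c, f x) = ∫ x in a..c, conj (f x) := by
  simp only [intervalIntegral, map_sub, integral_conj]

/-- `Re ∫ u·ū = ∫ |u|²`. [folklore] -/
private theorem re_integral_mul_conj_self (u : ℝ → ℂ) :
    (∫ x in (0:ℝ)..1, u x * conj (u x)).re = ∫ x in (0:ℝ)..1, ‖u x‖ ^ 2 := by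
  have h : (fun x => u x * conj (u x)) = fun x => (((‖u x‖ ^ 2 : ℝ)) : ℂ) := by
    funext x
    rw [Complex.mul_conj, Complex.normSq_eq_norm_sq]
  rw [h, intervalIntegral.integral_ofReal, Complex.ofReal_re]

/-- `Im ∫ u·conj v = −Im ∫ v·conj u`. [folklore] -/
private theorem im_integral_mul_conj_swap (u v : ℝ → ℂ) :
    (∫ x in (0:ℝ)..1, u x * conj (v x)).im = -(∫ x in (0:ℝ)..1, v x * conj (u x)).im := by
  have h : (fun x => u x * conj (v x)) = fun x => conj (v x * conj (u x)) := by
    funext x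
    rw [map_mul, Complex.conj_conj, mul_comm]
  rw [h, ← conj_intervalIntegral', Complex.conj_im]

/-- **The printed form against the core form** (pure bookkeeping, EVERY pair `(g, g′)`, no regularity needed):
`(π/8)·𝔅(g) = Re Q_{(6,11,6)}(g,g) − 3π²·Re(w̄(a₀+a₁)) + 2π·Im(a₀ā₁)` with `w = ∫₀¹ g`, `a₀ = g(0)`, `a₁ = g(1)`
(`mainTermForm_eq` versus `Det.re_shiftCore_self`; the term `Im|w|²` vanishes).
[cite: Zhang2022LandauSiegel, §7 Prop 7.1 p.44; §8 (8.11)–(8.23)] -/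
theorem pi_div_eight_mul_mainTermForm_eq (g g' : ℝ → ℂ) :
    π / 8 * mainTermForm g g'
      = (shiftCore 6 11 6 g g' g g').re
        + (-(3 * π ^ 2) * (conj (∫ t in (0:ℝ)..1, g t) * (g 0 + g 1)).re + 2 * π * (g 0 * conj (g 1)).im) := by
  rw [mainTermForm_eq, re_shiftCore_self, re_integral_mul_conj_self g', re_integral_mul_conj_self g,
    im_integral_mul_conj_swap g g', Complex.sub_im, Complex.mul_conj, Complex.ofReal_im]
  have hπ : (π : ℝ) ≠ 0 := Real.pi_ne_zero
  field_simp
  ring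

variable {g g' : ℝ → ℂ}

/-- **The tail-primitive piece**: `T_{(1,2,3)}^{[0,1]}(S_g) = Re Q_{(6,11,6)}(g,g)` for a kinked profile `g` (the tree's
[K1] dictionary `bulkFormOn_tailPrim_eq_re_shiftCore` at the printed triple). [cite: Zhang2022LandauSiegel, §7 Prop 7.1 p.44; §8 (8.11)–(8.23)] -/
theorem bulkFormOn_std_tailPrim (hg : Repair.KinkedProfile g g') :
    bulkFormOn ![1, 2, 3] 0 1 (tailPrim g) (fun y => -g y) (fun y => -g' y) = (shiftCore 6 11 6 g g' g g').re := by
  rw [bulkFormOn_tailPrim_eq_re_shiftCore _ hg, symE_std.1, symE_std.2.1, symE_std.2.2]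

/-- A `C¹` profile is a kinked profile (dot-notation adapter on the tree's `IsC1OnUnitInterval`, declared from this file).
[cite: Zhang2022LandauSiegel, §7 Prop 7.1 p.44] -/
theorem _root_.Literature.NumberTheory.LFunctions.Zhang2022.IsC1OnUnitInterval.kinkedProfile
    (hg : IsC1OnUnitInterval g g') : Repair.KinkedProfile g g' :=
  ⟨hg.cont, fun x hx => (hg.hasDeriv x hx).hasDerivWithinAt, memLp_two_of_continuousOn_Icc' hg.cont'⟩

end Printed

/-! ### Part 5 — the doubled `C¹` function on `[−1, 1]` and the two theorems of record -/

section Doubled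

/-- **The doubled function of a profile `g`** on the period cell `[−1, 1]`: the standard bridge
`F_{g(0), g(1), ∫g}` on `[−1, 0]` glued (at `0`) to the tail primitive `S_g = ∫_y^1 g` on `(0, 1]`; `C¹` at `0`
(`F(0) = S_g(0) = ∫g`, `F′(0) = −g(0)`) and `2`-periodically `C¹` at `±1` (`F(−1) = S_g(1) = 0`, `F′(−1) = −g(1)`).
[cite: Zhang2022LandauSiegel, §7 Prop 7.1 p.44; §8 (8.11)–(8.23)] -/
def mainTermDoubled (g : ℝ → ℂ) : ℝ → ℂ :=
  glue (extremal ![1, 2, 3] (stdBridgeCoeff (g 0) (g 1) (∫ t in (0:ℝ)..1, g t))) (tailPrim g)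

/-- Its derivative data `(F′ | −g)`. [cite: Zhang2022LandauSiegel, §7 Prop 7.1 p.44; §8 (8.11)–(8.23)] -/
def mainTermDoubledD (g : ℝ → ℂ) : ℝ → ℂ :=
  glue (extremalD ![1, 2, 3] (stdBridgeCoeff (g 0) (g 1) (∫ t in (0:ℝ)..1, g t))) (fun y => -g y)

/-- Its second-derivative data `(F″ | −g′)`. [cite: Zhang2022LandauSiegel, §7 Prop 7.1 p.44; §8 (8.11)–(8.23)] -/
def mainTermDoubledDD (g g' : ℝ → ℂ) : ℝ → ℂ :=
  glue (extremalDD ![1, 2, 3] (stdBridgeCoeff (g 0) (g 1) (∫ t in (0:ℝ)..1, g t))) (fun y => -g' y)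

/-- Continuity of a glued function on `[−1,1]` from an entire left piece, a right piece continuous on `[0,1]`, and
matching at `0`. [folklore] -/
private theorem continuousOn_glue {fL fR : ℝ → ℂ} (hL : Continuous fL) (hR : ContinuousOn fR (Icc 0 1))
    (h0 : fL 0 = fR 0) : ContinuousOn (glue fL fR) (Icc (-1) 1) := by
  unfold glue
  refine ContinuousOn.piecewise ?_ hL.continuousOn (hR.mono ?_)
  · intro a ha
    have ha' : a ∈ ({0} : Set ℝ) := by
      rw [← frontier_Iic]; exact ha.2
    rw [Set.mem_singleton_iff.1 ha']
    exact h0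
  · intro y hy
    have h2 := hy.2
    rw [closure_compl, interior_Iic, Set.mem_compl_iff, Set.mem_Iio, not_lt] at h2
    exact ⟨h2, hy.1.2⟩

/-- Right-derivative of a glued function off the node. [folklore] -/
private theorem hasDerivWithinAt_glue {fL fL' fR fR' : ℝ → ℂ} {y : ℝ} (hy : y ≠ 0)
    (hL : HasDerivAt fL (fL' y) y) (hR : 0 < y → HasDerivWithinAt fR (fR' y) (Ioi y) y) :
    HasDerivWithinAt (glue fL fR) (glue fL' fR' y) (Ioi y) y := by
  rcases lt_or_gt_of_ne hy with h | h
  · rw [glue_of_le h.le]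
    have hev : glue fL fR =ᶠ[𝓝 y] fL := by
      filter_upwards [Iio_mem_nhds h] with u hu
      exact glue_of_le (le_of_lt hu)
    exact (hL.congr_of_eventuallyEq hev).hasDerivWithinAt
  · rw [glue_of_pos h]
    have hev : glue fL fR =ᶠ[𝓝[Ioi y] y] fR := by
      filter_upwards [self_mem_nhdsWithin] with u hu
      exact glue_of_pos (h.trans hu)
    exact (hR h).congr_of_eventuallyEq hev (glue_of_pos h)

variable {g g' : ℝ → ℂ}

/-- **The tail primitive of a continuous profile**: `S_g = ∫_y^1 g` is continuous on `[0,1]`, has the integral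
representation `S_g(y) = S_g(0) + ∫₀^y (−g)`, and right-derivative `−g(y)` at every interior point.
[cite: Zhang2022LandauSiegel, §7 Prop 7.1 p.44; §8 (8.11)–(8.12)] -/
theorem tailPrim_regular (hgc : ContinuousOn g (Icc 0 1)) :
    ContinuousOn (tailPrim g) (Icc (0:ℝ) 1)
    ∧ (∀ y ∈ Icc (0:ℝ) 1, tailPrim g y = tailPrim g 0 + ∫ t in (0:ℝ)..y, (fun t => -g t) t)
    ∧ (∀ y ∈ Ioo (0:ℝ) 1, HasDerivWithinAt (tailPrim g) (-g y) (Ioi y) y) := by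
  have hgi : IntervalIntegrable g volume 0 1 := hgc.intervalIntegrable_of_Icc zero_le_one
  have hgn : ContinuousOn (fun y => -g y) (Icc (0:ℝ) 1) := hgc.neg
  have hrep : ∀ y ∈ Icc (0:ℝ) 1, tailPrim g y = tailPrim g 0 + ∫ t in (0:ℝ)..y, (fun t => -g t) t := by
    intro y hy
    rw [tailPrim_eq_sub hgi hy, tailPrim_zero, intervalIntegral.integral_neg]
    ring
  have hScont : ContinuousOn (tailPrim g) (Icc (0:ℝ) 1) := by
    have hint : IntervalIntegrable (fun t => -g t) volume 0 1 :=
      (hgn.mono (by rw [uIcc_of_le zero_le_one])).intervalIntegrable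
    have h := intervalIntegral.continuousOn_primitive_interval' hint (by simp : (0:ℝ) ∈ uIcc (0:ℝ) 1)
    rw [uIcc_of_le zero_le_one] at h
    exact (continuousOn_const.add h).congr fun y hy => hrep y hy
  exact ⟨hScont, hrep, hasDerivWithinAt_Ioi_of_integral_repr hgn hrep⟩

/-- **Regularity of the doubled function** (the seven hypotheses of the tree's [K3′] `hasSum_bulkFormOn_circle` on the
cell `[−1, 1]` with node set `{0}`): `S̃, S̃′` continuous on `[−1,1]`; right-derivatives `S̃ → S̃′ → S̃″` off `0`;
`S̃″ ∈ L²`; periodic `C¹` matching at `±1` — for every KINKED (`H¹`-type, right-differentiable) profile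
`Repair.KinkedProfile g g′`: in particular every `C¹` profile (`IsC1OnUnitInterval.kinkedProfile`) and the glued profiles of §18,
kink included. [cite: Zhang2022LandauSiegel, §7 Prop 7.1 p.44; §8 (8.11)–(8.23)] -/
theorem mainTermDoubled_regular (hg : Repair.KinkedProfile g g') :
    ContinuousOn (mainTermDoubled g) (Icc (-1) 1) ∧ ContinuousOn (mainTermDoubledD g) (Icc (-1) 1)
    ∧ (∀ y ∈ Ioo (-1:ℝ) 1, y ∉ ({0} : Finset ℝ) →
        HasDerivWithinAt (mainTermDoubled g) (mainTermDoubledD g y) (Ioi y) y)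
    ∧ (∀ y ∈ Ioo (-1:ℝ) 1, y ∉ ({0} : Finset ℝ) →
        HasDerivWithinAt (mainTermDoubledD g) (mainTermDoubledDD g g' y) (Ioi y) y)
    ∧ MemLp (mainTermDoubledDD g g') 2 (volume.restrict (Ioc (-1:ℝ) 1))
    ∧ mainTermDoubled g (-1) = mainTermDoubled g 1
    ∧ mainTermDoubledD g (-1) = mainTermDoubledD g 1 := by
  set γ : Fin 4 → ℂ := stdBridgeCoeff (g 0) (g 1) (∫ t in (0:ℝ)..1, g t) with hγ
  -- the right piece: tail primitive
  have hgc : ContinuousOn (fun y => -g y) (Icc (0:ℝ) 1) := hg.cont.neg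
  obtain ⟨hScont, -, hSder⟩ := tailPrim_regular hg.cont
  -- the left piece: the bridge (entire)
  have hF : Continuous (extremal ![1, 2, 3] γ) :=
    continuous_iff_continuousAt.2 fun t => (hasDerivAt_extremal _ γ t).continuousAt
  have hF1 : Continuous (extremalD ![1, 2, 3] γ) :=
    continuous_iff_continuousAt.2 fun t => (hasDerivAt_extremalD _ γ t).continuousAt
  have hF2 : Continuous (extremalDD ![1, 2, 3] γ) :=
    continuous_iff_continuousAt.2 fun t => (hasDerivAt_extremalDD _ γ t).continuousAt
  -- matching at the node and at the wrap
  have m0 : extremal ![1, 2, 3] γ 0 = tailPrim g 0 := by rw [hγ, stdBridge_zero, tailPrim_zero]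
  have m1 : extremalD ![1, 2, 3] γ 0 = -g 0 := by rw [hγ, stdBridgeD_zero]
  refine ⟨continuousOn_glue hF hScont m0, continuousOn_glue hF1 hgc m1, ?_, ?_, ?_, ?_, ?_⟩
  · intro y hyI hy0
    have hy : y ≠ 0 := fun h => hy0 (by rw [h]; exact Finset.mem_singleton_self 0)
    exact hasDerivWithinAt_glue hy (hasDerivAt_extremal _ γ y) fun hpos => hSder y ⟨hpos, hyI.2⟩
  · intro y hyI hy0
    have hy : y ≠ 0 := fun h => hy0 (by rw [h]; exact Finset.mem_singleton_self 0)
    exact hasDerivWithinAt_glue hy (hasDerivAt_extremalD _ γ y) fun hpos => (hg.hasDeriv y ⟨hpos, hyI.2⟩).neg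
  · exact memLp_glue (memLp_two_of_continuousOn_Icc' (hF2.continuousOn (s := Icc (-1:ℝ) 0))) hg.memLp.neg
  · show glue _ _ (-1) = glue _ _ 1
    rw [glue_of_le (by norm_num), glue_of_pos one_pos, stdBridge_neg_one, tailPrim_one]
  · show glue _ _ (-1) = glue _ _ 1
    rw [glue_of_le (by norm_num), glue_of_pos one_pos, stdBridgeD_neg_one]

/-- **The transform of the doubled function splits** into the bridge part and the tail-primitive part:
`∫_{−1}^{1} S̃_g k_m = ∫_{−1}^{0} F k_m + ∫_0^1 S_g k_m` (for consumers who evaluate the coefficients piecewise).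
[cite: Zhang2022LandauSiegel, §7 Prop 7.1 p.44; §8 (8.11)–(8.23)] -/
theorem dpiece_mainTermDoubled (hgc : ContinuousOn g (Icc 0 1)) (m : ℤ) :
    dpiece (-1) 1 (mainTermDoubled g) m
      = dpiece (-1) 0 (extremal ![1, 2, 3] (stdBridgeCoeff (g 0) (g 1) (∫ t in (0:ℝ)..1, g t))) m
        + dpiece 0 1 (tailPrim g) m := by
  set γ : Fin 4 → ℂ := stdBridgeCoeff (g 0) (g 1) (∫ t in (0:ℝ)..1, g t) with hγ
  have kcont : Continuous fun y : ℝ => cexp (-(I * π * m * y)) := by fun_prop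
  have hF : Continuous (extremal ![1, 2, 3] γ) :=
    continuous_iff_continuousAt.2 fun t => (hasDerivAt_extremal _ γ t).continuousAt
  have hL : IntervalIntegrable (fun y => extremal ![1, 2, 3] γ y * cexp (-(I * π * m * y))) volume (-1) 0 :=
    (hF.mul kcont).intervalIntegrable _ _
  have hR : IntervalIntegrable (fun y => tailPrim g y * cexp (-(I * π * m * y))) volume 0 1 :=
    ((tailPrim_regular hgc).1.mul kcont.continuousOn).intervalIntegrable_of_Icc zero_le_one
  have hglue : (fun y => mainTermDoubled g y * cexp (-(I * π * m * y)))
      = glue (fun y => extremal ![1, 2, 3] γ y * cexp (-(I * π * m * y)))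
          (fun y => tailPrim g y * cexp (-(I * π * m * y))) :=
    glue_map₁ (fun y z => z * cexp (-(I * π * m * y))) _ _
  unfold dpiece
  rw [hglue]
  exact (integral_glue hL hR).2

/-- **Id-6, closed form: `(π/8)·𝔅(g) = T_{(1,2,3)}^{[−1,1]}(S̃_g)`** — the printed main-term form of a kinked profile
`g` (NO condition at `1`, kinks allowed: window / overlap included) is the bulk form of its doubled function on the
period cell. [cite: Zhang2022LandauSiegel, §7 Prop 7.1 p.44; §8 (8.11)–(8.23)] -/
theorem pi_div_eight_mul_mainTermForm_eq_bulkFormOn (hg : Repair.KinkedProfile g g') :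
    π / 8 * mainTermForm g g'
      = bulkFormOn ![1, 2, 3] (-1) 1 (mainTermDoubled g) (mainTermDoubledD g) (mainTermDoubledDD g g') := by
  obtain ⟨R1, R2, -, -, R5, -, -⟩ := mainTermDoubled_regular hg
  rw [bulkFormOn_split _ R1 R2 R5]
  have hL : bulkFormOn ![1, 2, 3] (-1) 0 (mainTermDoubled g) (mainTermDoubledD g) (mainTermDoubledDD g g')
      = bulkFormOn ![1, 2, 3] (-1) 0 (extremal ![1, 2, 3] (stdBridgeCoeff (g 0) (g 1) (∫ t in (0:ℝ)..1, g t)))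
          (extremalD ![1, 2, 3] (stdBridgeCoeff (g 0) (g 1) (∫ t in (0:ℝ)..1, g t)))
          (extremalDD ![1, 2, 3] (stdBridgeCoeff (g 0) (g 1) (∫ t in (0:ℝ)..1, g t))) := by
    unfold bulkFormOn
    refine intervalIntegral.integral_congr fun y hy => ?_
    rw [uIcc_of_le (by norm_num)] at hy
    simp only [mainTermDoubled, mainTermDoubledD, mainTermDoubledDD, glue_of_le hy.2]
  have hR : bulkFormOn ![1, 2, 3] 0 1 (mainTermDoubled g) (mainTermDoubledD g) (mainTermDoubledDD g g')
      = bulkFormOn ![1, 2, 3] 0 1 (tailPrim g) (fun y => -g y) (fun y => -g' y) := by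
    unfold bulkFormOn
    refine intervalIntegral.integral_congr_ae ?_
    filter_upwards with y hy
    rw [uIoc_of_le zero_le_one] at hy
    simp only [mainTermDoubled, mainTermDoubledD, mainTermDoubledDD, glue_of_pos hy.1]
  rw [hL, hR, bulkFormOn_stdBridge, bulkFormOn_std_tailPrim hg, pi_div_eight_mul_mainTermForm_eq]
  ring

/-- The lattice symbol of the printed triple is `m(m+1)(m+2)(m+3) ≥ 0` on `ℤ`. [cite: Zhang2022LandauSiegel, §7 Prop 7.1 p.44] -/
theorem std_lattice_symbol_nonneg (m : ℤ) : 0 ≤ (m : ℝ) * ((m : ℝ) + 1) * ((m : ℝ) + 2) * ((m : ℝ) + 3) := by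
  have h := signAdmissible_std.bulkSymbol_intCast_nonneg m
  rw [bulkSymbol] at h
  simp only [Matrix.cons_val_zero, Matrix.cons_val_one, Matrix.head_cons, Matrix.cons_val_two,
    Matrix.tail_cons] at h
  have e : (m : ℝ) * ((m : ℝ) + 1) * ((m : ℝ) + 2) * ((m : ℝ) + 3)
      = (m : ℝ) * (((m : ℝ) + 1) * ((m : ℝ) + 2) * ((m : ℝ) + 3)) := by ring
  rw [e]; exact h

/-- **Id-6, Parseval form (theorem of record): the printed main-term form is Parseval-diagonal on `ℝ/2ℤ`** —
for every kinked profile `g` (`Repair.KinkedProfile g g′`; no condition at `1`, kinks allowed),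
`HasSum (m ↦ 4π³·m(m+1)(m+2)(m+3)·|∫_{−1}^{1} S̃_g e^{−iπm·}|²) (𝔅(g))`, `S̃_g = mainTermDoubled g` (equivalently
`𝔅(g) = 16π³·Σ_m m(m+1)(m+2)(m+3)·|ĉ_m|²` with Mathlib's normalised coefficient `ĉ_m = fourierCoeffOn = ½·dpiece`,
`Det.fourierCoeffOn_cell_eq`); by the tree's [K3′] `hasSum_bulkFormOn_circle` (base point `−1`, node set `{0}`) and
`pi_div_eight_mul_mainTermForm_eq_bulkFormOn`. [cite: Zhang2022LandauSiegel, §7 Prop 7.1 p.44; §8 (8.11)–(8.23)] -/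
theorem mainTermForm_hasSum_circle (hg : Repair.KinkedProfile g g') :
    HasSum (fun m : ℤ => 4 * π ^ 3 * ((m : ℝ) * ((m : ℝ) + 1) * ((m : ℝ) + 2) * ((m : ℝ) + 3))
        * ‖dpiece (-1) 1 (mainTermDoubled g) m‖ ^ 2) (mainTermForm g g') := by
  obtain ⟨R1, R2, R3, R4, R5, R6, R7⟩ := mainTermDoubled_regular hg
  have hc : (-1:ℝ) + 2 = 1 := by norm_num
  have K := hasSum_bulkFormOn_circle ![1, 2, 3] (-1) ({0} : Finset ℝ) (S := mainTermDoubled g)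
    (S' := mainTermDoubledD g) (S'' := mainTermDoubledDD g g')
    (by rw [hc]; exact R1) (by rw [hc]; exact R2) (by rw [hc]; exact R3) (by rw [hc]; exact R4)
    (by rw [hc]; exact R5) (by rw [hc]; exact R6) (by rw [hc]; exact R7)
  simp only [hc, std_sym.1, std_sym.2.1, std_sym.2.2] at K
  have K2 := K.mul_left (8 / π)
  rw [← pi_div_eight_mul_mainTermForm_eq_bulkFormOn hg] at K2
  have hπ : (π : ℝ) ≠ 0 := Real.pi_ne_zero
  have hval : 8 / π * (π / 8 * mainTermForm g g') = mainTermForm g g' := by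
    field_simp
  have hfun : (fun m : ℤ => 8 / π * (π ^ 4 / 2 *
        (((m : ℝ) ^ 4 + 6 * (m : ℝ) ^ 3 + 11 * (m : ℝ) ^ 2 + 6 * (m : ℝ)) * ‖dpiece (-1) 1 (mainTermDoubled g) m‖ ^ 2)))
      = fun m : ℤ => 4 * π ^ 3 * ((m : ℝ) * ((m : ℝ) + 1) * ((m : ℝ) + 2) * ((m : ℝ) + 3))
        * ‖dpiece (-1) 1 (mainTermDoubled g) m‖ ^ 2 := by
    funext m
    field_simp
    ring
  rw [hval, hfun] at K2
  exact K2

/-- The `C¹` case of `mainTermForm_hasSum_circle` (the hypothesis of the tree's `mainTermForm_nonneg`).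
[cite: Zhang2022LandauSiegel, §7 Prop 7.1 p.44; §8 (8.11)–(8.23)] -/
theorem mainTermForm_hasSum_circle_of_isC1 (hg : IsC1OnUnitInterval g g') :
    HasSum (fun m : ℤ => 4 * π ^ 3 * ((m : ℝ) * ((m : ℝ) + 1) * ((m : ℝ) + 2) * ((m : ℝ) + 3))
        * ‖dpiece (-1) 1 (mainTermDoubled g) m‖ ^ 2) (mainTermForm g g') :=
  mainTermForm_hasSum_circle hg.kinkedProfile

/-- **Corollary (O15 re-derived by Parseval)**: `0 ≤ 𝔅(g)` for every kinked profile (the tree's `mainTermForm_nonneg`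
/ `mainTermForm_nonneg_of_isH1`, here from the lattice positivity of `m(m+1)(m+2)(m+3)`).
[cite: Zhang2022LandauSiegel, §7 Prop 7.1 p.44; §8 (8.11)–(8.23)] -/
theorem mainTermForm_nonneg_of_hasSum_circle (hg : Repair.KinkedProfile g g') : 0 ≤ mainTermForm g g' :=
  (mainTermForm_hasSum_circle hg).nonneg fun m =>
    mul_nonneg (mul_nonneg (by positivity) (std_lattice_symbol_nonneg m)) (sq_nonneg _)

/-- **Corollary (the kernel in coefficient form)**: `𝔅(g) = 0` iff the doubled function `S̃_g` has no Fourier mass off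
the four lattice points `m ∈ {0, −1, −2, −3}` where the symbol vanishes — i.e. `S̃_g` is a cubic lattice trigonometric
polynomial `span{1, e^{−iπy}, e^{−2iπy}, e^{−3iπy}}` on the circle (the coefficient shadow of the tree's kernel theorem
`mainTermForm_eq_zero_iff_afeSpan`, `g ∈ span{e^{−iπy}, e^{−2iπy}, e^{−3iπy}}` on `[0,1]`).
[cite: Zhang2022LandauSiegel, §7 Prop 7.1 p.44; §8 (8.11)–(8.23)] -/
theorem mainTermForm_eq_zero_iff_dpiece (hg : Repair.KinkedProfile g g') :
    mainTermForm g g' = 0 ↔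
      ∀ m : ℤ, m ≠ 0 → m ≠ -1 → m ≠ -2 → m ≠ -3 → dpiece (-1) 1 (mainTermDoubled g) m = 0 := by
  have H := mainTermForm_hasSum_circle hg
  have hnn : ∀ m : ℤ, 0 ≤ 4 * π ^ 3 * ((m : ℝ) * ((m : ℝ) + 1) * ((m : ℝ) + 2) * ((m : ℝ) + 3))
      * ‖dpiece (-1) 1 (mainTermDoubled g) m‖ ^ 2 := fun m =>
    mul_nonneg (mul_nonneg (by positivity) (std_lattice_symbol_nonneg m)) (sq_nonneg _)
  constructor
  · intro h0 m hm0 hm1 hm2 hm3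
    rw [h0] at H
    have hf := congr_fun ((hasSum_zero_iff_of_nonneg hnn).1 H) m
    simp only [Pi.zero_apply] at hf
    have hp : (m : ℝ) * ((m : ℝ) + 1) * ((m : ℝ) + 2) * ((m : ℝ) + 3) ≠ 0 := by
      have e : (m : ℝ) * ((m : ℝ) + 1) * ((m : ℝ) + 2) * ((m : ℝ) + 3)
          = ((m * (m + 1) * (m + 2) * (m + 3) : ℤ) : ℝ) := by push_cast; ring
      rw [e]
      exact_mod_cast mul_ne_zero (mul_ne_zero (mul_ne_zero hm0 (by omega)) (by omega)) (by omega)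
    have h4 : (4 : ℝ) * π ^ 3 ≠ 0 := by positivity
    rcases mul_eq_zero.1 hf with h | h
    · rcases mul_eq_zero.1 h with h' | h'
      · exact absurd h' h4
      · exact absurd h' hp
    · exact norm_eq_zero.1 ((pow_eq_zero_iff two_ne_zero).1 h)
  · intro hz
    have hfz : (fun m : ℤ => 4 * π ^ 3 * ((m : ℝ) * ((m : ℝ) + 1) * ((m : ℝ) + 2) * ((m : ℝ) + 3))
        * ‖dpiece (-1) 1 (mainTermDoubled g) m‖ ^ 2) = fun _ => 0 := by
      funext m
      by_cases h0 : m = 0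
      · subst h0; simp
      by_cases h1 : m = -1
      · subst h1; push_cast; ring
      by_cases h2 : m = -2
      · subst h2; push_cast; ring
      by_cases h3 : m = -3
      · subst h3; push_cast; ring
      rw [hz m h0 h1 h2 h3, norm_zero]
      ring
    rw [hfz] at H
    exact H.unique hasSum_zero

end Doubled

end Det

end Literature.NumberTheory.LFunctions.Zhang2022
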